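import Literature.Analysis.FluidPDE.BarkerPrangeConcentrationProofs
import Literature.Analysis.FluidPDE.JiaSverak2014SlabAprioriEstimate
import Literature.Analysis.FluidPDE.CKNUnforcedOneScaleRRS
import Literature.Analysis.FluidPDE.CKNLocalRegularityRRSPressure
import HarnessLib

/-!
# Local energy solutions with a small `L³(ℝ³)` datum are bounded below the top of a short strip

Analysis/FluidPDE proof file (theorems only: no definitions, no named facts — D-0026), third
input of the compactness proof of the named fact
`Literature.Analysis.FluidPDE.BarkerPrange2020_thm2` (`BarkerPrangeConcentration.lean`,
`BarkerPrangeConcentrationCompactness.lean`; T. Barker, C. Prange, Arch. Ration. Mech. Anal.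
236 (2020) = arXiv:1812.09115, Theorem 2). In that proof the limit of the rescaled violators is
a unit-viscosity local energy solution `(u, p)` on a strip `ℝ³ × (0, σ)` whose datum lies in
`L³(ℝ³)` with `‖u₀‖₃ ≤ γ`; this file shows that for `γ ≤ γ₀` (universal) such a solution is
essentially bounded on a backward cylinder `Q_r(σ, 0)` with vertex at the top of the strip:

* `BarkerPrange2020.exists_eLpNorm_top_parabolicCylinder_lt_top_of_small_L3` — there is
  `γ₀ > 0` such that for every `σ > 0` and every local energy solution `(u, p)` on
  `ℝ³ × (0, σ)` (`IsLocalEnergySolutionOn σ 1 u₀ u p`) with `u₀ ∈ L³(ℝ³)`, `‖u₀‖₃ ≤ γ₀`, there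
  is `r > 0`, `r² < σ`, with `u ∈ L^∞(Q_r(σ, 0))`.

The argument is the classical one (Jia–Šverák 2013, Lemma 2 / Cor. 1 + Caffarelli–Kohn–Nirenberg;
Kang–Miura–Tsai 2021, Cor. 1.3 with `δ = ∞` is the printed statement closest to it: "Suppose
`v` is a local Leray solution … with initial data `v₀ ∈ L³_uloc ∩ E²` and
`sup_{x₀} ∫_{B_δ(x₀)} |v₀|³ ≤ ε₀³`. Then, there is `T > 0` such that `v` is regular in
`ℝ³ × (0, T)` with `|v(x,t)| ≤ C/√t`"), assembled from theorems of the tree: rescale by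
`R₀ = √(σ/ε₀)` (`IsLocalEnergySolutionOn.stRescale`; the `L³` norm of the datum is invariant),
so that the strip becomes `(0, ε₀)`, `ε₀` the absolute time of the a priori estimate; by Hölder
the rescaled datum has unit-ball energies `≤ 4γ²`, so Jia–Šverák's estimate at unit scale
(`apriori_unit_scale_slab`, with `α = 2γ²`) bounds the unit-ball energies, dissipations and the
gauged pressure on `(0, ε₀) × B₁(0)` by multiples of `γ²`, `γ²`, `γ³`; the cubic integral is
then `≲ γ³` by interpolation (`exists_lintegral_cube_window_le_slab`); and the one-scale
`ε`-regularity criterion at the vertex `(ε₀, 0)` of the backward cylinder `Q_{√ε₀}(ε₀, 0) =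
(0, ε₀) × B_{√ε₀}(0)` (Robinson–Rodrigo–Sadowski 2016, Thm. 15.3, in the shape
`unforced_epsilonRegularity_of_theorem15_3 RRS2016.theorem15_3_holds`, which allows the vertex
to sit on the top of the domain) bounds the rescaled solution on `Q_{√ε₀/2}(ε₀, 0)`, i.e. `u`
on `Q_{√σ/2}(σ, 0)`.

## Mathlib / tree search

Tree (reused): `apriori_unit_scale_slab`, `exists_lintegral_cube_window_le_slab`,
`unforced_epsilonRegularity_of_theorem15_3`, `RRS2016.theorem15_3_holds`,
`IsLRSuitableWeakSolutionOn`, `IsLocalEnergySolutionOn.stRescale`,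
`Seregin2014Limit.isSuitableWeakSolutionOn_sub_gauge`, `HasWeakSpatialGradientOn.ae_eq`,
`eLpNorm_top_uncurry_smul_stPull_preimage`, `memLp_comp_add_smul`, `map_space_affine_volume`,
`lintegral_enorm_sq_eq_eLpNorm_two_pow`, `volume_unitBall_rpow_third_le_two`,
`stAffine_preimage_cylinder` (`lean search 'small.*L3.*regular|regular.*small.*datum|Cor13'`:
no packaged statement over `IsLocalEnergySolutionOn`; the conditional
`leray_ae_eq_kato_of_local_leray_theory` needs the unproved weak–strong uniqueness fact and is
avoided). Mathlib: `eLpNorm_le_eLpNorm_mul_rpow_measure_univ`, `Measure.addHaar_ball_center`,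
`lintegral_prod_mul`, `Measure.prod_restrict`, `Convex.isConnected`, `isConnected_Ioo`,
`eLpNormEssSup_lt_top_of_ae_bound`.

## References

* T. Barker, C. Prange, Arch. Ration. Mech. Anal. 236 (2020) = arXiv:1812.09115, Thm. 2.
  [BarkerPrange2020]
* H. Jia, V. Šverák, SIAM J. Math. Anal. 45 (2013) = arXiv:1201.1592, Lemma 2, Cor. 1.
  [JiaSverak2013]
* K. Kang, H. Miura, T.-P. Tsai, IMRN 2021 = arXiv:1812.10509, Cor. 1.3. [KangMiuraTsai2020]
* J. C. Robinson, J. L. Rodrigo, W. Sadowski, *The three-dimensional Navier–Stokes equations*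
  (2016), Thm. 15.3. [RobinsonRodrigoSadowski2016]
-/

noncomputable section

open MeasureTheory Set Function Filter Metric Topology TopologicalSpace
open scoped ENNReal NNReal

namespace Literature.Analysis.FluidPDE

namespace BarkerPrange2020

/-! ### Tools -/

/-- **`L^p(ℝ³)` norms under `y ↦ x₀ + λ y`** (`λ > 0`, `p < ∞`):
`‖F(x₀ + λ ·)‖_{L^p(ℝ³)} = (λ⁻³)^{1/p} ‖F‖_{L^p(ℝ³)}` (whole-space twin of
`eLpNorm_comp_add_smul_ball`). [folklore] -/
theorem eLpNorm_comp_add_smul_univ {F' : Type*} [NormedAddCommGroup F']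
    (F : EuclideanSpace ℝ (Fin 3) → F') (x₀ : EuclideanSpace ℝ (Fin 3)) {l : ℝ} (hl : 0 < l)
    {p : ℝ≥0∞} (hp : p ≠ ∞) :
    eLpNorm (fun y => F (x₀ + l • y)) p volume =
      ENNReal.ofReal ((l ^ 3)⁻¹) ^ (1 / p).toReal * eLpNorm F p volume := by
  set e := spaceAffineHomeomorph hl.ne' x₀ with he
  have hme : MeasurableEmbedding e := e.measurableEmbedding
  have hcoe : (e : EuclideanSpace ℝ (Fin 3) → EuclideanSpace ℝ (Fin 3)) = fun y => x₀ + l • y := rfl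
  have h2 := hme.eLpNorm_map_measure (g := F) (p := p) (μ := (volume : Measure (EuclideanSpace ℝ (Fin 3))))
  rw [hcoe, map_space_affine_volume hl x₀, finrank_euclideanSpace_fin,
    eLpNorm_smul_measure_of_ne_top hp, smul_eq_mul] at h2
  rw [show (fun y => F (x₀ + l • y)) = F ∘ fun y => x₀ + l • y from rfl, ← h2]

/-- **A time gauge controlled on a box is `L^{3/2}` in time.** If `f ∈ L^{3/2}((0,T) × B₁(0))`
and `f - c(t) ∈ L^{3/2}((0,T) × B₁(0))` for a measurable `c : ℝ → ℝ`, then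
`∫₀ᵀ |c|^{3/2} < ∞` (integrate `|c|^{3/2} ≤ √2 (|f|^{3/2} + |f - c|^{3/2})` over the box and
use Tonelli). [folklore] -/
theorem lintegral_gauge_rpow_lt_top {T : ℝ} {c : ℝ → ℝ} (hc : Measurable c)
    {f : ℝ → EuclideanSpace ℝ (Fin 3) → ℝ}
    (hf : AEStronglyMeasurable (uncurry f)
      (volume.restrict (Ioo 0 T ×ˢ ball (0 : EuclideanSpace ℝ (Fin 3)) 1)))
    (h1 : ∫⁻ z in Ioo 0 T ×ˢ ball (0 : EuclideanSpace ℝ (Fin 3)) 1, ‖f z.1 z.2‖ₑ ^ (3 / 2 : ℝ) < ∞)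
    (h2 : ∫⁻ z in Ioo 0 T ×ˢ ball (0 : EuclideanSpace ℝ (Fin 3)) 1,
      ‖f z.1 z.2 - c z.1‖ₑ ^ (3 / 2 : ℝ) < ∞) :
    ∫⁻ t in Ioo 0 T, ‖c t‖ₑ ^ (3 / 2 : ℝ) < ∞ := by
  set B : Set (EuclideanSpace ℝ (Fin 3)) := ball 0 1 with hB
  set μ : Measure (ℝ × EuclideanSpace ℝ (Fin 3)) := volume.restrict (Ioo 0 T ×ˢ B) with hμ
  -- pointwise: `|c|^{3/2} ≤ 2^{1/2} (|f|^{3/2} + |f - c|^{3/2})`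
  have hpt : ∀ z : ℝ × EuclideanSpace ℝ (Fin 3), ‖c z.1‖ₑ ^ (3 / 2 : ℝ) ≤
      (2 : ℝ≥0∞) ^ ((3 / 2 : ℝ) - 1) *
        (‖f z.1 z.2‖ₑ ^ (3 / 2 : ℝ) + ‖f z.1 z.2 - c z.1‖ₑ ^ (3 / 2 : ℝ)) := by
    intro z
    have hsub : ‖c z.1‖ₑ ≤ ‖f z.1 z.2‖ₑ + ‖f z.1 z.2 - c z.1‖ₑ := by
      have e : (c z.1 : ℝ) = f z.1 z.2 - (f z.1 z.2 - c z.1) := by ring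
      calc ‖c z.1‖ₑ = ‖f z.1 z.2 - (f z.1 z.2 - c z.1)‖ₑ := by rw [← e]
        _ ≤ ‖f z.1 z.2‖ₑ + ‖f z.1 z.2 - c z.1‖ₑ := enorm_sub_le
    exact (ENNReal.rpow_le_rpow hsub (by norm_num)).trans
      (ENNReal.rpow_add_le_mul_rpow_add_rpow _ _ (by norm_num : (1 : ℝ) ≤ 3 / 2))
  have hfm : AEMeasurable (fun z : ℝ × EuclideanSpace ℝ (Fin 3) => ‖f z.1 z.2‖ₑ ^ (3 / 2 : ℝ)) μ :=
    hf.aemeasurable.enorm.pow_const _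
  have hbox : ∫⁻ z, ‖c z.1‖ₑ ^ (3 / 2 : ℝ) ∂μ < ∞ := by
    calc ∫⁻ z, ‖c z.1‖ₑ ^ (3 / 2 : ℝ) ∂μ
        ≤ ∫⁻ z, (2 : ℝ≥0∞) ^ ((3 / 2 : ℝ) - 1) *
            (‖f z.1 z.2‖ₑ ^ (3 / 2 : ℝ) + ‖f z.1 z.2 - c z.1‖ₑ ^ (3 / 2 : ℝ)) ∂μ := lintegral_mono hpt
      _ = (2 : ℝ≥0∞) ^ ((3 / 2 : ℝ) - 1) *
            ((∫⁻ z, ‖f z.1 z.2‖ₑ ^ (3 / 2 : ℝ) ∂μ) + ∫⁻ z, ‖f z.1 z.2 - c z.1‖ₑ ^ (3 / 2 : ℝ) ∂μ) := by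
          rw [lintegral_const_mul' _ _ (ENNReal.rpow_ne_top_of_nonneg (by norm_num) ENNReal.ofNat_ne_top),
            lintegral_add_left' hfm]
      _ < ∞ := ENNReal.mul_lt_top (ENNReal.rpow_lt_top_of_nonneg (by norm_num) ENNReal.ofNat_ne_top)
          (ENNReal.add_lt_top.2 ⟨h1, h2⟩)
  -- Tonelli: the box integral of a function of time is `|B| ∫₀ᵀ`
  have hprod : μ = (volume.restrict (Ioo 0 T)).prod (volume.restrict B) := by
    rw [hμ, Measure.prod_restrict, ← Measure.volume_eq_prod]
  have hcm : AEMeasurable (fun t : ℝ => ‖c t‖ₑ ^ (3 / 2 : ℝ)) (volume.restrict (Ioo 0 T)) :=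
    (hc.enorm.pow_const _).aemeasurable
  have hTon : ∫⁻ z, ‖c z.1‖ₑ ^ (3 / 2 : ℝ) ∂μ =
      (∫⁻ t in Ioo 0 T, ‖c t‖ₑ ^ (3 / 2 : ℝ)) * volume B := by
    have e : (fun z : ℝ × EuclideanSpace ℝ (Fin 3) => ‖c z.1‖ₑ ^ (3 / 2 : ℝ)) =
        fun z => (fun t : ℝ => ‖c t‖ₑ ^ (3 / 2 : ℝ)) z.1 * (fun _ : EuclideanSpace ℝ (Fin 3) => (1 : ℝ≥0∞)) z.2 := by
      funext z; simp
    rw [hprod, e, lintegral_prod_mul hcm aemeasurable_const, lintegral_const, Measure.restrict_apply_univ,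
      one_mul]
  have hB0 : volume B ≠ 0 := (measure_ball_pos volume _ one_pos).ne'
  rw [hTon] at hbox
  exact lt_top_iff_ne_top.2 fun h => by
    rw [h, ENNReal.top_mul hB0] at hbox
    exact lt_irrefl _ hbox

/-- `(∫⁻ ‖f‖ₑ²) = (eLpNorm f 2 μ)²` (local copy of the tool of `NSSereginMildCompactness.lean`,
not imported here). [folklore] -/
private theorem lintegral_enorm_sq_eq_eLpNorm_two_pow' {α F : Type*} [MeasurableSpace α]
    [NormedAddCommGroup F] (μ : Measure α) (f : α → F) :
    ∫⁻ x, ‖f x‖ₑ ^ 2 ∂μ = eLpNorm f 2 μ ^ 2 := by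
  rw [eLpNorm_eq_lintegral_rpow_enorm_toReal (by norm_num) (by norm_num), ENNReal.toReal_ofNat,
    ← ENNReal.rpow_natCast, ← ENNReal.rpow_mul]
  norm_num

/-- **Unit-ball energies of an `L³` field** (Hölder on a ball of `ℝ³`, `|B₁|^{1/6} ≤ 2`):
`∫_{B₁(x₀)} |f|² ≤ 4 ‖f‖₃²`, written as `≤ 2 · (2γ²)` for `‖f‖₃ ≤ γ`. [folklore] -/
theorem lintegral_unitBall_sq_le_of_eLpNorm_three_le
    {f : EuclideanSpace ℝ (Fin 3) → EuclideanSpace ℝ (Fin 3)} (hf : AEStronglyMeasurable f volume)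
    {γ : ℝ≥0} (h3 : eLpNorm f 3 volume ≤ γ) (x₀ : EuclideanSpace ℝ (Fin 3)) :
    ∫⁻ x in ball x₀ 1, ‖f x‖ₑ ^ 2 ≤ 2 * ((2 * γ ^ 2 : ℝ≥0) : ℝ≥0∞) := by
  set μB : Measure (EuclideanSpace ℝ (Fin 3)) := volume.restrict (ball x₀ 1) with hμB
  have hvol : μB univ = volume (ball (0 : EuclideanSpace ℝ (Fin 3)) 1) := by
    rw [hμB, Measure.restrict_apply_univ, Measure.addHaar_ball_center]
  have hH := eLpNorm_le_eLpNorm_mul_rpow_measure_univ (by norm_num : (2 : ℝ≥0∞) ≤ 3)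
    (hf.mono_measure Measure.restrict_le_self : AEStronglyMeasurable f μB)
  have hexp : (1 / (2 : ℝ≥0∞).toReal - 1 / (3 : ℝ≥0∞).toReal : ℝ) = 1 / 6 := by norm_num
  rw [hexp, hvol] at hH
  have hV : volume (ball (0 : EuclideanSpace ℝ (Fin 3)) 1) ^ (1 / 6 : ℝ) ≤ 2 := by
    have h1 : volume (ball (0 : EuclideanSpace ℝ (Fin 3)) 1) ^ (1 / 6 : ℝ) =
        (volume (ball (0 : EuclideanSpace ℝ (Fin 3)) 1) ^ (1 / 3 : ℝ)) ^ (1 / 2 : ℝ) := by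
      rw [← ENNReal.rpow_mul]; norm_num
    rw [h1]
    calc (volume (ball (0 : EuclideanSpace ℝ (Fin 3)) 1) ^ (1 / 3 : ℝ)) ^ (1 / 2 : ℝ)
        ≤ (2 : ℝ≥0∞) ^ (1 / 2 : ℝ) := ENNReal.rpow_le_rpow volume_unitBall_rpow_third_le_two (by norm_num)
      _ ≤ (2 : ℝ≥0∞) ^ (1 : ℝ) := ENNReal.rpow_le_rpow_of_exponent_le (by norm_num) (by norm_num)
      _ = 2 := ENNReal.rpow_one 2
  have h3B : eLpNorm f 3 μB ≤ γ := (eLpNorm_mono_measure f Measure.restrict_le_self).trans h3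
  have h2 : eLpNorm f 2 μB ≤ (γ : ℝ≥0∞) * 2 :=
    hH.trans (mul_le_mul' h3B hV)
  rw [lintegral_enorm_sq_eq_eLpNorm_two_pow']
  calc eLpNorm f 2 μB ^ 2 ≤ ((γ : ℝ≥0∞) * 2) ^ 2 := pow_le_pow_left' h2 2
    _ = 2 * ((2 * γ ^ 2 : ℝ≥0) : ℝ≥0∞) := by push_cast; ring

/-! ### The regularity statement -/
set_option maxHeartbeats 400000 in -- buildfix (bf3-g26): 160k/180k FAIL, 200k PASS at accept time; line-neutral budget line
/-- **Local energy solutions with a small `L³(ℝ³)` datum are bounded below the top of the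
strip.** There is an absolute `γ₀ > 0` such that: if `(u, p)` is a unit-viscosity local energy
solution on `ℝ³ × (0, σ)` (`IsLocalEnergySolutionOn σ 1 u₀ u p`, any `σ > 0`) whose datum lies in
`L³(ℝ³)` with `‖u₀‖₃ ≤ γ₀`, then `u` is essentially bounded on the backward cylinder
`Q_r(σ, 0)`, `r = √σ/2`. Proof (module docstring): rescale by `R₀ = √(σ/ε₀)` to the strip
`(0, ε₀)`; Hölder gives unit-ball energies `≤ 4γ₀²` for the (scale-invariant) datum;
Jia–Šverák's a priori estimate at unit scale (`α = 2γ₀²`) bounds energies, dissipations and the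
gauged pressure on `(0, ε₀) × B₁(0)`; interpolation bounds the cubic integral; the one-scale
`ε`-regularity criterion at the vertex `(ε₀, 0)` (Robinson–Rodrigo–Sadowski's Thm. 15.3)
concludes. (Kang–Miura–Tsai 2021, Cor. 1.3 is the printed global-smallness statement; here
only the top of the strip above the origin is needed.)
[cite: KangMiuraTsai2020, Cor. 1.3 (arXiv:1812.10509 p. 3)] [cite: JiaSverak2013, Lemma 2 and Cor. 1 (arXiv:1201.1592 pp. 3–4)] [cite: RobinsonRodrigoSadowski2016, Thm. 15.3] -/
theorem exists_eLpNorm_top_parabolicCylinder_lt_top_of_small_L3 :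
    ∃ γ₀ : ℝ, 0 < γ₀ ∧ ∀ (σ : ℝ), 0 < σ →
      ∀ (u₀ : EuclideanSpace ℝ (Fin 3) → EuclideanSpace ℝ (Fin 3))
        (u : ℝ → EuclideanSpace ℝ (Fin 3) → EuclideanSpace ℝ (Fin 3))
        (p : ℝ → EuclideanSpace ℝ (Fin 3) → ℝ),
        IsLocalEnergySolutionOn σ 1 u₀ u p → MemLp u₀ 3 volume →
        eLpNorm u₀ 3 volume ≤ ENNReal.ofReal γ₀ →
        ∃ r : ℝ, 0 < r ∧ r ^ 2 < σ ∧
          eLpNorm (uncurry u) ∞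
            (volume.restrict (parabolicCylinder r ((σ : ℝ), (0 : EuclideanSpace ℝ (Fin 3))))) < ∞ := by
  -- ### the absolute constants
  obtain ⟨ε₀, hε₀, hε₀1, C, hAP⟩ := JiaSverak2014.apriori_unit_scale_slab
  obtain ⟨εr, C₀, hεr, -, hREG⟩ :=
    unforced_epsilonRegularity_of_theorem15_3 RRS2016.theorem15_3_holds
  obtain ⟨Kc, hKc⟩ := JiaSverak2014.exists_lintegral_cube_window_le_slab (1 : ℝ)
  have hε₀' : (0 : ℝ) < ε₀ := by exact_mod_cast hε₀
  have hε₀1' : (ε₀ : ℝ) ≤ 1 := by exact_mod_cast hε₀1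
  -- `K' γ³` bounds the cubic plus gauged-pressure integral of the rescaled solution
  set K' : ℝ := 16 * Kc * C * Real.sqrt C + 2 * Real.sqrt 2 * C with hK'
  have hK'0 : 0 ≤ K' := by rw [hK']; positivity
  set γ₀ : ℝ := min (1 / 2) (εr ^ 3 * ε₀ / (K' + 1)) with hγ₀
  have hγ₀pos : 0 < γ₀ := lt_min (by norm_num) (by positivity)
  have hγ₀half : γ₀ ≤ 1 / 2 := min_le_left _ _
  have hγ₀K : K' * γ₀ ≤ εr ^ 3 * ε₀ := by
    have h1 : γ₀ ≤ εr ^ 3 * ε₀ / (K' + 1) := min_le_right _ _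
    calc K' * γ₀ ≤ (K' + 1) * (εr ^ 3 * ε₀ / (K' + 1)) := by gcongr; linarith
      _ = εr ^ 3 * ε₀ := by field_simp
  refine ⟨γ₀, hγ₀pos, fun σ hσ u₀ u p hsol hu₀ hsmall => ?_⟩
  -- ### the rescaling to the strip `(0, ε₀)`
  have hq : 0 < σ / ε₀ := div_pos hσ hε₀'
  obtain ⟨R₀, hR₀_def, hR₀, hR₀2⟩ :
      ∃ R₀ : ℝ, R₀ = Real.sqrt (σ / ε₀) ∧ 0 < R₀ ∧ R₀ ^ 2 = σ / ε₀ :=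
    ⟨_, rfl, Real.sqrt_pos.2 hq, Real.sq_sqrt hq.le⟩
  have hR₀0 : R₀ ≠ 0 := hR₀.ne'
  have hσ0 : σ ≠ 0 := hσ.ne'
  have hε₀0 : (ε₀ : ℝ) ≠ 0 := hε₀'.ne'
  have hβ : (0 : ℝ) < R₀ ^ 2 := by positivity
  have hsolR := hsol.stRescale (α := R₀) (β := R₀ ^ 2) (γ := R₀) hR₀ hR₀ (by rw [sq])
    (0 : EuclideanSpace ℝ (Fin 3))
  have he1 : σ / R₀ ^ 2 = ε₀ := by
    rw [hR₀2]; field_simp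
  have he2 : R₀ * 1 / R₀ = 1 := by field_simp
  rw [he1, he2] at hsolR
  set ut : ℝ → EuclideanSpace ℝ (Fin 3) → EuclideanSpace ℝ (Fin 3) :=
    R₀ • stPull (R₀ ^ 2) R₀ 0 (0 : EuclideanSpace ℝ (Fin 3)) u with hut_def
  set pt : ℝ → EuclideanSpace ℝ (Fin 3) → ℝ :=
    R₀ ^ 2 • stPull (R₀ ^ 2) R₀ 0 (0 : EuclideanSpace ℝ (Fin 3)) p with hpt_def
  set at₀ : EuclideanSpace ℝ (Fin 3) → EuclideanSpace ℝ (Fin 3) :=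
    fun y => R₀ • u₀ (0 + R₀ • y) with hat_def
  -- ### the rescaled datum: in `L³` with the same norm, unit-ball energies `≤ 4 γ₀²`
  have hat3 : MemLp at₀ 3 volume := (memLp_comp_add_smul hu₀ 0 hR₀).const_smul R₀
  set γn : ℝ≥0 := γ₀.toNNReal with hγn
  have hγn_coe : (γn : ℝ) = γ₀ := Real.coe_toNNReal _ hγ₀pos.le
  have hγnE : ENNReal.ofReal γ₀ = (γn : ℝ≥0∞) := rfl
  have hat_norm : eLpNorm at₀ 3 volume ≤ (γn : ℝ≥0∞) := by
    have hsm : eLpNorm at₀ 3 volume = ‖R₀‖ₑ * eLpNorm (fun y => u₀ (0 + R₀ • y)) 3 volume := by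
      rw [hat_def, show (fun y => R₀ • u₀ (0 + R₀ • y)) = R₀ • fun y => u₀ (0 + R₀ • y) from rfl,
        eLpNorm_const_smul]
    rw [hsm, eLpNorm_comp_add_smul_univ u₀ 0 hR₀ (by norm_num), ofReal_inv_cube_rpow_third hR₀,
      Real.enorm_eq_ofReal hR₀.le, ← mul_assoc, ← ENNReal.ofReal_mul hR₀.le,
      mul_inv_cancel₀ hR₀0, ENNReal.ofReal_one, one_mul, ← hγnE]
    exact hsmall
  set α : ℝ≥0 := 2 * γn ^ 2 with hα
  have hdat : ∀ x₀ : EuclideanSpace ℝ (Fin 3),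
      ∫⁻ x in ball x₀ 1, ‖at₀ x‖ₑ ^ 2 ≤ 2 * (α : ℝ≥0∞) := fun x₀ =>
    lintegral_unitBall_sq_le_of_eLpNorm_three_le hat3.aestronglyMeasurable hat_norm x₀
  have hγn1 : (γn : ℝ) ≤ 1 / 2 := by rw [hγn_coe]; exact hγ₀half
  have hα1 : (α : ℝ) ≤ 1 := by
    have h0 : 0 ≤ (γn : ℝ) := γn.coe_nonneg
    have e : (α : ℝ) = 2 * (γn : ℝ) ^ 2 := by rw [hα]; push_cast; ring
    have h1 : (γn : ℝ) ^ 2 ≤ (1 / 2) ^ 2 := pow_le_pow_left₀ h0 hγn1 2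
    rw [e]; linarith
  have hTα : (ε₀ : ℝ) * (α : ℝ) ^ 2 ≤ ε₀ := by
    have h0 : 0 ≤ (α : ℝ) := α.coe_nonneg
    have h1 : (α : ℝ) ^ 2 ≤ 1 := pow_le_one₀ h0 hα1
    calc (ε₀ : ℝ) * (α : ℝ) ^ 2 ≤ ε₀ * 1 := mul_le_mul_of_nonneg_left h1 hε₀'.le
      _ = ε₀ := mul_one _
  -- ### Jia–Šverák's a priori estimate at unit scale on `(0, ε₀)`
  have hsuitR := hsolR.suitable
  obtain ⟨G₁, hG₁, -, -⟩ := hsuitR.localEnergy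
  obtain ⟨hE, hD, hP⟩ := hAP at₀ ut pt G₁ α ε₀ ε₀ hat3.aestronglyMeasurable
    hsolR.isLocalLeraySolutionOn hG₁ hdat hε₀' le_rfl le_rfl hTα
  obtain ⟨c, hcm, hcP⟩ := hP 0
  set Mb : ℝ≥0∞ := 2 * ((C * α : ℝ≥0) : ℝ≥0∞) with hMb
  have hMbtop : Mb ≠ ⊤ := ENNReal.mul_ne_top ENNReal.ofNat_ne_top ENNReal.coe_ne_top
  have hE0 : ∀ᵐ t ∂(volume.restrict (Ioo (0 : ℝ) ε₀)),
      ∫⁻ x in ball (0 : EuclideanSpace ℝ (Fin 3)) 1, ‖ut t x‖ₑ ^ 2 ≤ Mb :=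
    hE.mono fun t ht => ht 0
  have hD0 : ∫⁻ z in Ioo (0 : ℝ) ε₀ ×ˢ ball (0 : EuclideanSpace ℝ (Fin 3)) 1,
      ENNReal.ofReal (frobeniusNormSq (G₁ z.1 z.2)) ≤ Mb :=
    (hD 0).trans (by rw [hMb]; exact le_mul_of_one_le_left bot_le one_le_two)
  -- the cubic integral by interpolation
  have hcube := hKc ut G₁ ε₀ 0 ε₀ 0 Mb le_rfl hε₀'.le le_rfl (by rw [sub_zero]; exact hε₀1') hMbtop
    hG₁ hE0 hD0
  -- ### the gauge is `L^{3/2}` in time; the gauged pair is suitable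
  set box : Set (ℝ × EuclideanSpace ℝ (Fin 3)) :=
    Ioo (0 : ℝ) ε₀ ×ˢ ball (0 : EuclideanSpace ℝ (Fin 3)) 1 with hbox
  have hbox_sub : box ⊆ Ioo (0 : ℝ) ε₀ ×ˢ (univ : Set (EuclideanSpace ℝ (Fin 3))) :=
    prod_mono Subset.rfl (subset_univ _)
  have hum : AEStronglyMeasurable (uncurry ut) (volume.restrict box) :=
    hsolR.aestronglyMeasurable.mono_measure (Measure.restrict_mono hbox_sub le_rfl)
  have hpm : AEStronglyMeasurable (uncurry pt) (volume.restrict box) :=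
    hsolR.isLocalLeraySolutionOn.aestronglyMeasurable_pressure.mono_measure
      (Measure.restrict_mono hbox_sub le_rfl)
  have hp1 : ∫⁻ z in box, ‖pt z.1 z.2‖ₑ ^ (3 / 2 : ℝ) < ∞ :=
    (lintegral_mono_set (Set.prod_mono Subset.rfl ball_subset_closedBall)).trans_lt
      (hsolR.pressure (closedBall 0 1) (isCompact_closedBall 0 1))
  have hp2 : ∫⁻ z in box, ‖pt z.1 z.2 - c z.1‖ₑ ^ (3 / 2 : ℝ) < ∞ :=
    hcP.trans_lt ENNReal.coe_lt_top
  have hcT : ∫⁻ t in Ioo (0 : ℝ) ε₀, ‖c t‖ₑ ^ (3 / 2 : ℝ) < ∞ :=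
    lintegral_gauge_rpow_lt_top hcm hpm hp1 hp2
  have hsuit' := Seregin2014Limit.isSuitableWeakSolutionOn_sub_gauge hsuitR hcm hcT
  obtain ⟨G₂, hG₂, -, hLE₂⟩ := hsuit'.localEnergy
  have hGae := hG₁.ae_eq hG₂
  -- ### the §14.3 hypotheses on the box `(0, ε₀) × B₁(0)`
  set Qbox : Opens (ℝ × EuclideanSpace ℝ (Fin 3)) :=
    ⟨box, isOpen_Ioo.prod isOpen_ball⟩ with hQbox
  have hQcoe : (Qbox : Set (ℝ × EuclideanSpace ℝ (Fin 3))) = box := rfl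
  have hQle : Qbox ≤ slab (EuclideanSpace ℝ (Fin 3)) (Ioo 0 ε₀) isOpen_Ioo :=
    fun z hz => mem_slab.2 (show z ∈ box from hz).1
  have hGbox : ∀ᵐ z ∂(volume.restrict box), uncurry G₁ z = uncurry G₂ z :=
    ae_restrict_of_ae_restrict_of_subset (by rw [coe_slab]; exact hbox_sub) hGae
  have hLR : IsLRSuitableWeakSolutionOn Qbox 1 3 0 ut (fun t x => pt t x - c t) G₂ :=
    { isConnected := by
        rw [hQcoe, hbox]
        exact (isConnected_Ioo hε₀').prod
          ((convex_ball (0 : EuclideanSpace ℝ (Fin 3)) 1).isConnected ⟨0, mem_ball_self one_pos⟩)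
      energyClass := by
        refine ⟨2 * (C * α), ?_⟩
        have hE0' := (ae_restrict_iff' (measurableSet_Ioo : MeasurableSet (Ioo (0 : ℝ) ε₀))).1 hE0
        filter_upwards [hE0'] with t ht
        by_cases htI : t ∈ Ioo (0 : ℝ) ε₀
        · have hfun : (fun x : EuclideanSpace ℝ (Fin 3) => (Qbox : Set (ℝ × EuclideanSpace ℝ (Fin 3))).indicator
              (fun z : ℝ × EuclideanSpace ℝ (Fin 3) => ‖ut z.1 z.2‖ₑ ^ 2) (t, x)) =
              (ball (0 : EuclideanSpace ℝ (Fin 3)) 1).indicator (fun x => ‖ut t x‖ₑ ^ 2) := by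
            funext x
            by_cases hx : x ∈ ball (0 : EuclideanSpace ℝ (Fin 3)) 1
            · rw [indicator_of_mem (show (t, x) ∈ (Qbox : Set _) from ⟨htI, hx⟩), indicator_of_mem hx]
            · rw [indicator_of_notMem (show (t, x) ∉ (Qbox : Set _) from fun h => hx h.2),
                indicator_of_notMem hx]
          rw [hfun, lintegral_indicator measurableSet_ball]
          refine (ht htI).trans (le_of_eq ?_)
          rw [hMb]; push_cast; ring
        · have hfun : (fun x : EuclideanSpace ℝ (Fin 3) => (Qbox : Set (ℝ × EuclideanSpace ℝ (Fin 3))).indicator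
              (fun z : ℝ × EuclideanSpace ℝ (Fin 3) => ‖ut z.1 z.2‖ₑ ^ 2) (t, x)) = fun _ => 0 := by
            funext x
            rw [indicator_of_notMem (show (t, x) ∉ (Qbox : Set _) from fun h => htI h.1)]
          rw [hfun, lintegral_zero]
          exact bot_le
      weakGradient := hG₂.mono hQle
      gradient_lt_top := by
        rw [hQcoe]
        have e : ∫⁻ z in box, ENNReal.ofReal (frobeniusNormSq (G₂ z.1 z.2)) =
            ∫⁻ z in box, ENNReal.ofReal (frobeniusNormSq (G₁ z.1 z.2)) :=
          lintegral_congr_ae (hGbox.mono fun z hz => by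
            change ENNReal.ofReal (frobeniusNormSq (uncurry G₂ z)) =
              ENNReal.ofReal (frobeniusNormSq (uncurry G₁ z))
            rw [hz])
        rw [e]
        exact hD0.trans_lt hMbtop.lt_top
      pressure_lt_top := by rw [hQcoe]; exact hp2
      force_memLp := by rw [uncurry_zero]; exact MemLp.zero
      distributional := hsuit'.distributional.of_le hQle
      localEnergy := fun φ hφ hφ0 => hLE₂ φ (hφ.mono hQle) hφ0 }
  -- ### the one-scale criterion at the vertex `(ε₀, 0)`, radius `ρ = √ε₀`
  obtain ⟨ρ, hρ_def, hρ, hρ2⟩ : ∃ ρ : ℝ, ρ = Real.sqrt ε₀ ∧ 0 < ρ ∧ ρ ^ 2 = ε₀ :=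
    ⟨_, rfl, Real.sqrt_pos.2 hε₀', Real.sq_sqrt hε₀'.le⟩
  have hρ1 : ρ ≤ 1 := by
    rw [hρ_def, show (1 : ℝ) = Real.sqrt 1 from Real.sqrt_one.symm]
    exact Real.sqrt_le_sqrt hε₀1'
  set z₀ : ℝ × EuclideanSpace ℝ (Fin 3) := ((ε₀ : ℝ), (0 : EuclideanSpace ℝ (Fin 3))) with hz₀
  have hcyl : parabolicCylinder ρ z₀ ⊆ (Qbox : Set (ℝ × EuclideanSpace ℝ (Fin 3))) := by
    intro w hw
    rw [mem_parabolicCylinder] at hw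
    have h1 : z₀.1 = (ε₀ : ℝ) := rfl
    have h2 : z₀.2 = (0 : EuclideanSpace ℝ (Fin 3)) := rfl
    rw [h1, h2] at hw
    refine ⟨⟨by nlinarith [hw.1.1], hw.1.2⟩, mem_ball.2 (lt_of_lt_of_le hw.2 hρ1)⟩
  -- smallness: cubic `≤ 16 Kc C √C γ₀³`, pressure `≤ 2√2 C γ₀³`, sum `≤ εr³ ρ²`
  have hcubeR : ∫⁻ z in box, ‖ut z.1 z.2‖ₑ ^ (3 : ℕ) ≤
      ENNReal.ofReal (16 * Kc * C * Real.sqrt C * γ₀ ^ 3) := by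
    refine hcube.trans ?_
    have hMbR : Mb = ENNReal.ofReal (4 * C * γ₀ ^ 2) := by
      have h1 : (4 * (C : ℝ) * γ₀ ^ 2) = ((4 * C * γn ^ 2 : ℝ≥0) : ℝ) := by
        push_cast; rw [hγn_coe]
      rw [h1, ENNReal.ofReal_coe_nnreal, hMb, hα]
      push_cast
      ring
    have hx0 : 0 ≤ 4 * (C : ℝ) * γ₀ ^ 2 := by positivity
    have hrp : (4 * (C : ℝ) * γ₀ ^ 2) ^ (3 / 2 : ℝ) = 8 * C * Real.sqrt C * γ₀ ^ 3 := by
      have hy : 0 ≤ 2 * γ₀ * Real.sqrt C := by positivity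
      have e1 : 4 * (C : ℝ) * γ₀ ^ 2 = (2 * γ₀ * Real.sqrt C) ^ 2 := by
        rw [mul_pow, mul_pow, Real.sq_sqrt C.coe_nonneg]; ring
      have e2 : ((2 * γ₀ * Real.sqrt C) ^ 2) ^ (3 / 2 : ℝ) = (2 * γ₀ * Real.sqrt C) ^ (3 : ℕ) := by
        rw [← Real.rpow_natCast _ 2, ← Real.rpow_mul hy, ← Real.rpow_natCast _ 3]
        norm_num
      have e3 : Real.sqrt C ^ 3 = C * Real.sqrt C := by
        rw [pow_succ, Real.sq_sqrt C.coe_nonneg]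
      rw [e1, e2, mul_pow, mul_pow, e3]
      ring
    have hone : ENNReal.ofReal ((ε₀ : ℝ) - 0) ^ (1 / 4 : ℝ) ≤ 1 :=
      ENNReal.rpow_le_one (ENNReal.ofReal_le_one.2 (by linarith)) (by norm_num)
    calc 2 * (Kc : ℝ≥0∞) * Mb ^ (3 / 2 : ℝ) * ENNReal.ofReal ((ε₀ : ℝ) - 0) ^ (1 / 4 : ℝ)
        ≤ 2 * (Kc : ℝ≥0∞) * Mb ^ (3 / 2 : ℝ) * 1 := by gcongr
      _ = ENNReal.ofReal (16 * Kc * C * Real.sqrt C * γ₀ ^ 3) := by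
          rw [mul_one, hMbR, ENNReal.ofReal_rpow_of_nonneg hx0 (by norm_num), hrp,
            ← ENNReal.ofReal_coe_nnreal, ← ENNReal.ofReal_ofNat 2,
            ← ENNReal.ofReal_mul (by norm_num), ← ENNReal.ofReal_mul (by positivity)]
          congr 1; ring
  have hpresR : ∫⁻ z in box, ‖pt z.1 z.2 - c z.1‖ₑ ^ (3 / 2 : ℝ) ≤
      ENNReal.ofReal (2 * Real.sqrt 2 * C * γ₀ ^ 3) := by
    refine hcP.trans (le_of_eq ?_)
    rw [← ENNReal.ofReal_coe_nnreal]
    congr 1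
    rw [hα]
    push_cast
    rw [hγn_coe, Real.sqrt_mul' 2 (sq_nonneg γ₀), Real.sqrt_sq hγ₀pos.le]
    ring
  have hsum : 16 * Kc * C * Real.sqrt C * γ₀ ^ 3 + 2 * Real.sqrt 2 * C * γ₀ ^ 3 ≤ εr ^ 3 * ρ ^ 2 := by
    rw [hρ2]
    have h1 : γ₀ ^ 2 ≤ 1 := pow_le_one₀ hγ₀pos.le (hγ₀half.trans (by norm_num))
    have h3 : γ₀ ^ 3 ≤ γ₀ := by
      calc γ₀ ^ 3 = γ₀ * γ₀ ^ 2 := by ring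
        _ ≤ γ₀ * 1 := mul_le_mul_of_nonneg_left h1 hγ₀pos.le
        _ = γ₀ := mul_one _
    have h4 : 16 * Kc * C * Real.sqrt C * γ₀ ^ 3 + 2 * Real.sqrt 2 * C * γ₀ ^ 3 = K' * γ₀ ^ 3 := by
      rw [hK']; ring
    rw [h4]
    exact (mul_le_mul_of_nonneg_left h3 hK'0).trans hγ₀K
  have humeas : AEMeasurable (fun w : ℝ × EuclideanSpace ℝ (Fin 3) => ‖ut w.1 w.2‖ₑ ^ (3 : ℕ))
      (volume.restrict box) := hum.aemeasurable.enorm.pow_const _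
  have hsmallR : ∫⁻ w in parabolicCylinder ρ z₀,
      (‖ut w.1 w.2‖ₑ ^ (3 : ℕ) + ‖(fun t x => pt t x - c t) w.1 w.2‖ₑ ^ (3 / 2 : ℝ)) ≤
      ENNReal.ofReal (εr ^ 3 * ρ ^ 2) := by
    calc ∫⁻ w in parabolicCylinder ρ z₀,
          (‖ut w.1 w.2‖ₑ ^ (3 : ℕ) + ‖(fun t x => pt t x - c t) w.1 w.2‖ₑ ^ (3 / 2 : ℝ))
        ≤ ∫⁻ w in box, (‖ut w.1 w.2‖ₑ ^ (3 : ℕ) + ‖pt w.1 w.2 - c w.1‖ₑ ^ (3 / 2 : ℝ)) :=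
          lintegral_mono_set hcyl
      _ = (∫⁻ w in box, ‖ut w.1 w.2‖ₑ ^ (3 : ℕ)) + ∫⁻ w in box, ‖pt w.1 w.2 - c w.1‖ₑ ^ (3 / 2 : ℝ) :=
          lintegral_add_left' humeas _
      _ ≤ ENNReal.ofReal (16 * Kc * C * Real.sqrt C * γ₀ ^ 3) +
            ENNReal.ofReal (2 * Real.sqrt 2 * C * γ₀ ^ 3) := add_le_add hcubeR hpresR
      _ = ENNReal.ofReal (16 * Kc * C * Real.sqrt C * γ₀ ^ 3 + 2 * Real.sqrt 2 * C * γ₀ ^ 3) :=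
          (ENNReal.ofReal_add (by positivity) (by positivity)).symm
      _ ≤ ENNReal.ofReal (εr ^ 3 * ρ ^ 2) := ENNReal.ofReal_le_ofReal hsum
  have key := hREG Qbox 3 ut (fun t x => pt t x - c t) G₂ (by norm_num) hLR z₀ ρ εr hρ hcyl hεr.le
    le_rfl hsmallR
  have hbddR : eLpNorm (uncurry ut) ∞ (volume.restrict (parabolicCylinder (ρ / 2) z₀)) < ∞ := by
    rw [eLpNorm_exponent_top]
    exact eLpNormEssSup_lt_top_of_ae_bound key
  -- ### back to `u`: `Q_{ρ/2}(ε₀, 0)` is the preimage of `Q_{R₀ ρ/2}(σ, 0)`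
  set r : ℝ := R₀ * ρ / 2 with hr
  have hr0 : 0 < r := by positivity
  have hr2 : r ^ 2 = σ / 4 := by
    rw [hr, div_pow, mul_pow, hR₀2, hρ2]; field_simp; norm_num
  have hrσ : r ^ 2 < σ := by rw [hr2]; linarith
  have hpre : stAffine (R₀ ^ 2) R₀ 0 (0 : EuclideanSpace ℝ (Fin 3)) ⁻¹'
      parabolicCylinder r ((σ : ℝ), (0 : EuclideanSpace ℝ (Fin 3))) = parabolicCylinder (ρ / 2) z₀ := by
    rw [parabolicCylinder, parabolicCylinder, stAffine_preimage_cylinder hβ hR₀]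
    show Ioo ((σ - r ^ 2 - 0) / R₀ ^ 2) ((σ - 0) / R₀ ^ 2) ×ˢ
        ball (R₀⁻¹ • ((0 : EuclideanSpace ℝ (Fin 3)) - 0)) (r / R₀) =
      Ioo ((ε₀ : ℝ) - (ρ / 2) ^ 2) (ε₀ : ℝ) ×ˢ ball (0 : EuclideanSpace ℝ (Fin 3)) (ρ / 2)
    simp only [sub_zero, smul_zero]
    have e1 : (σ - r ^ 2) / R₀ ^ 2 = (ε₀ : ℝ) - (ρ / 2) ^ 2 := by
      rw [hr2, hR₀2, div_pow, hρ2]; field_simp; ring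
    have e2 : σ / R₀ ^ 2 = (ε₀ : ℝ) := by rw [hR₀2]; field_simp
    have e3 : r / R₀ = ρ / 2 := by rw [hr]; field_simp
    rw [e1, e2, e3]
  have htrans := eLpNorm_top_uncurry_smul_stPull_preimage hβ hR₀ 0 (0 : EuclideanSpace ℝ (Fin 3)) R₀ u
    (parabolicCylinder r ((σ : ℝ), (0 : EuclideanSpace ℝ (Fin 3))))
  rw [hpre] at htrans
  rw [hut_def] at hbddR
  rw [htrans] at hbddR
  refine ⟨r, hr0, hrσ, ?_⟩
  rcases ENNReal.mul_lt_top_iff.1 hbddR with (⟨-, h⟩ | h | h)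
  · exact h
  · exact absurd h (by simp [hR₀0])
  · rw [h]; exact ENNReal.zero_lt_top

end BarkerPrange2020

end Literature.Analysis.FluidPDE

end
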